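import Summits.CriticalPhenomena.PercolationContinuityZ3.Theorems.PercNearOneGluingNoHeavyLowerTailPinnedCATools
import HarnessLib

/-!
# `NoHeavyLowerTail` (stmt-CriticalPhenomena-4575) — pinned conditional association across a vertex
# separator: given no open `o–b` path avoiding `S`, the events `{o ↔ S}` and `{b ↔ S}` are negatively
# correlated

Support file (`--supports stmt-CriticalPhenomena-4575`), lemma factory #7 (`prim-lf-7`, k-cluster conditional
association, gen 6).  No definitions, no named facts, no sorries.

Let `G` be a finite weighted graph (`μ = prodBernoulli w` on a finite vertex type `V`), `S ⊆ V` a vertex set and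
`o, b ∉ S` distinct.  Write `{x ↔ S} = ⋃_{s ∈ S} {x ↔ s}` and `D_S = (openConnIn Sᶜ o b)ᶜ` for the event that there is
NO open path from `o` to `b` avoiding `S`.

* `PinnedCA.pinned_negCorrelation` — **Theorem.**
  `μ(D_S) · μ(D_S ∩ {o ↔ S} ∩ {b ↔ S}) ≤ μ(D_S ∩ {o ↔ S}) · μ(D_S ∩ {b ↔ S})`.
  For `S = ∅` both sides vanish; for `S = V ∖ {o,b}` it is trivial; in between it is the statement that the two
  halves of an `o–b` connection PINNED at the separator `S` are conditionally negatively correlated.  It is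
  van den Berg–Häggström–Kahn's eq. (2) / Thm. 1.4 (RSA 2006; tree: `BHK2006_twoClusterConditionalAssociation_holds`)
  applied in the graph `G ∖ S` to the two ATTACHMENT FUNCTIONS `u_S(C) = μ(some pair between C and S is open)`
  of the clusters of `o` and `b` off `S` (increasing cluster functions), combined with the independence of the
  pairs meeting `S` from the pairs inside `Sᶜ` (the set version of the "green bridge" of
  `…Q7PsiGreen`: given the configuration off `S`, `o ↔ S` iff some pair from the off-`S` cluster of `o` to `S`
  is open, and on `D_S` the clusters of `o` and `b` off `S` are disjoint, so the two attachment events use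
  disjoint sets of pairs).  It is strictly stronger than eq. (2) in `G` itself (which conditions on `{o ↮ b}`:
  here the extra mass `μ({o ↔ b only through S}) · μ(o | S | b)` sits on the small side).
* `PinnedCA.cutVertex_cells` — the case `S = {a}` in partition-cell form:
  `μ(o ↔ a, a ↔ b, o ↮ b off a) · μ(o | a | b) ≤ μ(oa | b) · μ(ab | o)`,
  i.e. "all three joined with `a` a cut vertex between `o` and `b`" times "all three separated" is at most
  the product of the two one-link cells.  (The analogous statement with further terminals required to be
  separated from everything is FALSE — exact 7-vertex witness in the seat memo RANK-ONE.md §7 of prim-lf-7 —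
  because the mixture over the other terminals' clusters breaks it; the present three-terminal form is the
  theorem behind that discussion.)

Proof structure (tools in `…NoHeavyLowerTailPinnedCATools`): `first_entrance` (path algebra), `determinedBy_*` /
`cross_disjoint_*` (which pairs decide which events), the product formula on each fibre of the pair of off-`S`
clusters (`prodBernoulli_real_inter_of_determinedBy`), `setIntegral_eq_sum_fibre` (finite disintegration),
transport to the vertex type `↥Sᶜ` (`KNPreFKG.real_preimage_restrictConfig_val`) and BHK Thm. 1.4 there
(`BHK2006_twoClusterConditionalAssociation_holds.negCorrelation` with `KNPreFKG.monotone_clusterFun`).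
[cite: VandenbergHaggstromKahn2005, eq. (2) (p. 2), Thms 1.4–1.5 (p. 7)] [cite: Grimmett1999, §2.2 (product measure)]
-/

namespace Summit.CriticalPhenomena.PercolationContinuityZ3.Theorems

open MeasureTheory Set Literature.Probability.LatticeModels Literature.Probability.Percolation
open scoped Classical
open KNPreFKG

noncomputable section

namespace PinnedCA

variable {V : Type*}

/-! ### The theorem -/

section Main

variable [Fintype V]

/-- **Pinned conditional association across a vertex separator.**  For a vertex set `S` and distinct
`o, b ∉ S`, with `D_S = (openConnIn Sᶜ o b)ᶜ` ("no open `o–b` path avoiding `S`") and `{x ↔ S} = ⋃_{s∈S} {x ↔ s}`: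
`μ(D_S) · μ(D_S ∩ {o ↔ S} ∩ {b ↔ S}) ≤ μ(D_S ∩ {o ↔ S}) · μ(D_S ∩ {b ↔ S})`.
van den Berg–Häggström–Kahn's Thm. 1.4 in `G ∖ S` for the attachment functions of the two off-`S` clusters,
plus independence of the pairs meeting `S`. [cite: VandenbergHaggstromKahn2005, eq. (2) (p. 2) and Thm. 1.4 (p. 7)] -/
theorem pinned_negCorrelation (w : Sym2 V → unitInterval) (S : Set V) {o b : V}
    (ho : o ∉ S) (hb : b ∉ S) (hob : o ≠ b) :
    (prodBernoulli w).real (openConnIn Sᶜ o b)ᶜ *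
        (prodBernoulli w).real ((openConnIn Sᶜ o b)ᶜ ∩ ((⋃ s ∈ S, openConn o s) ∩ ⋃ s ∈ S, openConn b s)) ≤
      (prodBernoulli w).real ((openConnIn Sᶜ o b)ᶜ ∩ ⋃ s ∈ S, openConn o s) *
        (prodBernoulli w).real ((openConnIn Sᶜ o b)ᶜ ∩ ⋃ s ∈ S, openConn b s) := by
  classical
  set μ := prodBernoulli w with hμ
  -- the restriction to `R = Sᶜ`
  set R : Set V := Sᶜ with hR
  have hoR : o ∈ R := ho
  have hbR : b ∈ R := hb
  set o' : ↥R := ⟨o, hoR⟩ with ho'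
  set b' : ↥R := ⟨b, hbR⟩ with hb'
  have hob' : o' ≠ b' := fun h => hob (congrArg Subtype.val h)
  set r : BondConfig V → BondConfig ↥R := restrictConfig (Subtype.val : ↥R → V) with hr
  set μR := prodBernoulli (w ∘ Sym2.map (Subtype.val : ↥R → V)) with hμR
  have hmeas : ∀ Z : Set (BondConfig V), MeasurableSet Z := fun _ => MeasurableSet.of_discrete
  -- clusters on `R` as finsets, the fibre maps
  set cl : ↥R → BondConfig ↥R → Finset ↥R :=
    fun x ω' => Finset.univ.filter fun y => (openGraph ω').Reachable x y with hcl
  set Ψ : BondConfig ↥R → Finset ↥R × Finset ↥R := fun ω' => (cl o' ω', cl b' ω') with hΨ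
  set Φ : BondConfig V → Finset ↥R × Finset ↥R := fun ω => Ψ (r ω) with hΦ
  -- attachment events / pairs / function
  set X : Finset ↥R → Set (BondConfig V) := fun T => {ω | ∃ t ∈ T, ∃ s ∈ S, s((t : V), s) ∈ ω} with hX
  set P : Finset ↥R → Set (Sym2 V) := fun T => {e | ∃ t ∈ T, ∃ s ∈ S, e = s((t : V), s)} with hP
  set Uset : Set ↥R → ℝ := fun A => μ.real {ω : BondConfig V | ∃ t ∈ A, ∃ s ∈ S, s((t : V), s) ∈ ω}
    with hUset
  set U : Finset ↥R → ℝ := fun T => Uset ↑T with hU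
  have hUX : ∀ T, U T = μ.real (X T) := fun T => rfl
  have hUmono : ∀ A B : Set ↥R, A ⊆ B → Uset A ≤ Uset B := by
    intro A B hAB
    exact measureReal_mono (fun ω ⟨t, ht, s, hs, hts⟩ => ⟨t, hAB ht, s, hs, hts⟩)
  set Fin : Set (Sym2 V) := Set.range (Sym2.map (Subtype.val : ↥R → V)) with hFin
  -- the events
  set D : Set (BondConfig V) := (openConnIn Sᶜ o b)ᶜ with hD
  set DR : Set (BondConfig ↥R) := {ω' | ¬ (openGraph ω').Reachable o' b'} with hDR
  set Ao : Set (BondConfig V) := ⋃ s ∈ S, openConn o s with hAo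
  set Ab : Set (BondConfig V) := ⋃ s ∈ S, openConn b s with hAb
  -- (1) `D` is the pull-back of `DR`
  have hDpre : D = r ⁻¹' DR := by
    have h1 : r ⁻¹' (openConn o' b') = openConnIn R o b := preimage_openConn_val R hoR hbR
    rw [hD, ← hR, ← h1, ← preimage_compl]
    rfl
  -- (2) membership in the off-`S` clusters
  have hmem_cl : ∀ (x : ↥R) (ω : BondConfig V) (y : ↥R), y ∈ cl x (r ω) ↔ ω ∈ openConnIn R x y := by
    intro x ω y
    rw [hcl]
    simp only [Finset.mem_filter, Finset.mem_univ, true_and]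
    exact reachable_restrictConfig_val_iff R ω x y
  have hcoe_cl : ∀ (x : ↥R) (ω' : BondConfig ↥R), (↑(cl x ω') : Set ↥R) = openCluster ω' x := by
    intro x ω'
    ext y
    rw [hcl]
    simp only [Finset.coe_filter, Finset.mem_univ, true_and, mem_setOf_eq]
    rfl
  -- (3) on a fibre, attachment of `x` to `S` is the cross event of the cluster of `x`
  have hattach : ∀ (x : V) (hx : x ∈ R) (ω : BondConfig V),
      (ω ∈ ⋃ s ∈ S, openConn x s) ↔ ω ∈ X (cl ⟨x, hx⟩ (r ω)) := by
    intro x hx ω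
    have h1 : (ω ∈ ⋃ s ∈ S, openConn x s) ↔ ∃ s ∈ S, (openGraph ω).Reachable x s := by
      simp only [mem_iUnion, exists_prop]
      rfl
    rw [h1, first_entrance S hx ω, hX]
    simp only [mem_setOf_eq]
    constructor
    · rintro ⟨t, ht, s, hs, hts⟩
      exact ⟨⟨t, ht.2.1⟩, (hmem_cl ⟨x, hx⟩ ω ⟨t, ht.2.1⟩).2 ht, s, hs, hts⟩
    · rintro ⟨t, ht, s, hs, hts⟩
      exact ⟨t, (hmem_cl ⟨x, hx⟩ ω t).1 ht, s, hs, hts⟩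
  -- (4) the product formula on each fibre
  have hfib : ∀ c : Finset ↥R × Finset ↥R,
      μ.real (D ∩ (Ao ∩ Ab) ∩ Φ ⁻¹' {c}) = μ.real (D ∩ Φ ⁻¹' {c}) * (U c.1 * U c.2) ∧
      μ.real (D ∩ Ao ∩ Φ ⁻¹' {c}) = μ.real (D ∩ Φ ⁻¹' {c}) * U c.1 ∧
      μ.real (D ∩ Ab ∩ Φ ⁻¹' {c}) = μ.real (D ∩ Φ ⁻¹' {c}) * U c.2 := by
    intro c
    obtain ⟨T, T'⟩ := c
    set Y : Set (BondConfig V) := D ∩ Φ ⁻¹' {(T, T')} with hY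
    -- `Y` is decided by the pairs inside `R`
    have hYpre : Y = r ⁻¹' (DR ∩ Ψ ⁻¹' {(T, T')}) := by
      rw [hY, hDpre]
      rfl
    have hYdet : DeterminedBy Y Fin := by
      rw [hYpre]
      exact determinedBy_preimage_restrict R _
    -- on `Y`, the clusters are `T`, `T'` and the attachment events are the cross events
    have hYo : ∀ ω ∈ Y, cl o' (r ω) = T := fun ω hω => (Prod.mk.inj (mem_singleton_iff.1 hω.2)).1
    have hYb : ∀ ω ∈ Y, cl b' (r ω) = T' := fun ω hω => (Prod.mk.inj (mem_singleton_iff.1 hω.2)).2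
    have hYAo : Y ∩ Ao = Y ∩ X T := by
      ext ω
      constructor
      · rintro ⟨hω, hA⟩
        exact ⟨hω, hYo ω hω ▸ (hattach o hoR ω).1 hA⟩
      · rintro ⟨hω, hA⟩
        exact ⟨hω, (hattach o hoR ω).2 (hYo ω hω ▸ hA)⟩
    have hYAb : Y ∩ Ab = Y ∩ X T' := by
      ext ω
      constructor
      · rintro ⟨hω, hA⟩
        exact ⟨hω, hYb ω hω ▸ (hattach b hbR ω).1 hA⟩
      · rintro ⟨hω, hA⟩
        exact ⟨hω, (hattach b hbR ω).2 (hYb ω hω ▸ hA)⟩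
    -- independence of one cross event from `Y`
    have hind1 : ∀ T₀ : Finset ↥R, μ.real (Y ∩ X T₀) = μ.real Y * U T₀ := by
      intro T₀
      rw [hUX]
      have hB : DeterminedBy (X T₀) (↑Fin.toFinset : Set (Sym2 V))ᶜ := by
        rw [Set.coe_toFinset]
        exact (determinedBy_cross S T₀).mono
          fun e he => Set.disjoint_left.1 (cross_disjoint_inside S T₀) he
      have hA : DeterminedBy Y (↑Fin.toFinset : Set (Sym2 V)) := by
        rw [Set.coe_toFinset]
        exact hYdet
      exact prodBernoulli_real_inter_of_determinedBy w Fin.toFinset hA hB (hmeas _) (hmeas _)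
    -- rearrangements of the intersections
    have e1 : D ∩ (Ao ∩ Ab) ∩ Φ ⁻¹' {(T, T')} = (Y ∩ Ao) ∩ Ab := by
      rw [hY]; ext ω; simp only [mem_inter_iff]; tauto
    have e2 : D ∩ Ao ∩ Φ ⁻¹' {(T, T')} = Y ∩ Ao := by
      rw [hY]; ext ω; simp only [mem_inter_iff]; tauto
    have e3 : D ∩ Ab ∩ Φ ⁻¹' {(T, T')} = Y ∩ Ab := by
      rw [hY]; ext ω; simp only [mem_inter_iff]; tauto
    refine ⟨?_, ?_, ?_⟩
    · -- two-point formula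
      rw [e1, hYAo]
      by_cases hdisj : Disjoint T T'
      · -- `(Y ∩ X T) ∩ X T'`: independence with support `Fin ∪ P T`
        have hYXb : (Y ∩ X T) ∩ Ab = (Y ∩ X T) ∩ X T' := by
          rw [inter_assoc, inter_comm (X T) Ab, ← inter_assoc, hYAb]
          ext ω; simp only [mem_inter_iff]; tauto
        rw [hYXb]
        have hA : DeterminedBy (Y ∩ X T) (↑(Fin ∪ P T).toFinset : Set (Sym2 V)) := by
          rw [Set.coe_toFinset]
          exact (hYdet.mono subset_union_left).inter ((determinedBy_cross S T).mono subset_union_right)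
        have hB : DeterminedBy (X T') (↑(Fin ∪ P T).toFinset : Set (Sym2 V))ᶜ := by
          rw [Set.coe_toFinset]
          refine (determinedBy_cross S T').mono fun e he => ?_
          rintro (h | h)
          · exact Set.disjoint_left.1 (cross_disjoint_inside S T') he h
          · exact Set.disjoint_left.1 (cross_disjoint_cross S hdisj) h he
        rw [prodBernoulli_real_inter_of_determinedBy w (Fin ∪ P T).toFinset hA hB (hmeas _) (hmeas _),
          hind1 T, ← hUX, mul_assoc]
      · -- the fibre is empty on `D`
        have hYempty : Y = ∅ := by
          refine Set.eq_empty_iff_forall_notMem.2 fun ω hω => ?_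
          obtain ⟨y, hyT, hyT'⟩ := Finset.not_disjoint_iff.1 hdisj
          have h1 : ω ∈ openConnIn R o y := (hmem_cl o' ω y).1 (hYo ω hω ▸ hyT)
          have h2 : ω ∈ openConnIn R b y := (hmem_cl b' ω y).1 (hYb ω hω ▸ hyT')
          obtain ⟨hb2, hy2, hr2⟩ := h2
          exact hω.1 (openConnIn_trans h1 ⟨hy2, hb2, hr2.symm⟩)
        rw [hYempty]
        simp
    · rw [e2, hYAo, hind1 T]
    · rw [e3, hYAb, hind1 T']
  -- (5) sum over the fibres and transport to `R`
  have htrans : ∀ c : Finset ↥R × Finset ↥R, μ.real (D ∩ Φ ⁻¹' {c}) = μR.real (DR ∩ Ψ ⁻¹' {c}) := by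
    intro c
    have h1 : D ∩ Φ ⁻¹' {c} = r ⁻¹' (DR ∩ Ψ ⁻¹' {c}) := by
      rw [hDpre]
      rfl
    rw [h1]
    exact real_preimage_restrictConfig_val w R _
  have hS0 : μ.real D = μR.real DR := by
    rw [real_eq_sum_fibre μ Φ D, real_eq_sum_fibre μR Ψ DR]
    exact Finset.sum_congr rfl fun c _ => htrans c
  have hS2 : μ.real (D ∩ (Ao ∩ Ab)) = ∫ ω' in DR, U (cl o' ω') * U (cl b' ω') ∂μR := by
    rw [real_eq_sum_fibre μ Φ (D ∩ (Ao ∩ Ab)),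
      setIntegral_eq_sum_fibre μR Ψ (fun c => U c.1 * U c.2) DR]
    exact Finset.sum_congr rfl fun c _ => by rw [(hfib c).1, htrans c]
  have hSo : μ.real (D ∩ Ao) = ∫ ω' in DR, U (cl o' ω') ∂μR := by
    rw [real_eq_sum_fibre μ Φ (D ∩ Ao), setIntegral_eq_sum_fibre μR Ψ (fun c => U c.1) DR]
    exact Finset.sum_congr rfl fun c _ => by rw [(hfib c).2.1, htrans c]
  have hSb : μ.real (D ∩ Ab) = ∫ ω' in DR, U (cl b' ω') ∂μR := by
    rw [real_eq_sum_fibre μ Φ (D ∩ Ab), setIntegral_eq_sum_fibre μR Ψ (fun c => U c.2) DR]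
    exact Finset.sum_congr rfl fun c _ => by rw [(hfib c).2.2, htrans c]
  -- (6) BHK Thm. 1.4 on `R` for the two attachment functions
  have key := BHK2006_twoClusterConditionalAssociation_holds.negCorrelation (↥R)
    (w ∘ Sym2.map (Subtype.val : ↥R → V)) o' b'
    (fun C => Uset {a | a = o' ∨ ∃ e ∈ C, a ∈ e}) (fun C => Uset {a | a = b' ∨ ∃ e ∈ C, a ∈ e})
    (monotone_clusterFun o' Uset hUmono) (monotone_clusterFun b' Uset hUmono) hob'
  simp only [clusterFun_openEdgeCluster] at key
  have hUcl : ∀ (x : ↥R) (ω' : BondConfig ↥R), Uset (openCluster ω' x) = U (cl x ω') := by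
    intro x ω'
    show Uset (openCluster ω' x) = Uset ↑(cl x ω')
    rw [hcoe_cl]
  simp only [hUcl] at key
  -- `key : μR.real DR * ∫_{DR} U(cl o') U(cl b') ≤ (∫_{DR} U(cl o')) (∫_{DR} U(cl b'))`
  rw [hS0, hS2, hSo, hSb]
  exact key

/-- **The cut-vertex case in partition cells.**  For distinct `o, a, b`:
`μ(o ↔ a, a ↔ b, o ↮ b off a) · μ(o ∣ a ∣ b) ≤ μ(o ↔ a, a ↮ b) · μ(a ↔ b, o ↮ a)` —
"all joined with `a` a cut vertex between `o` and `b`" × "all separated" ≤ "`oa ∣ b`" × "`ab ∣ o`".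
(`pinned_negCorrelation` with `S = {a}`, and `c(c+p+q+s) ≤ (c+p)(c+q) ⟺ cs ≤ pq`.)
[cite: VandenbergHaggstromKahn2005, eq. (2) (p. 2) and Thm. 1.4 (p. 7)] -/
theorem cutVertex_cells (w : Sym2 V → unitInterval) {o a b : V} (hoa : o ≠ a) (hab : a ≠ b) (hob : o ≠ b) :
    (prodBernoulli w).real (openConn o a ∩ openConn a b ∩ (openConnIn ({a}ᶜ : Set V) o b)ᶜ) *
        (prodBernoulli w).real ((openConn o a)ᶜ ∩ (openConn a b)ᶜ ∩ (openConn o b)ᶜ) ≤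
      (prodBernoulli w).real (openConn o a ∩ (openConn a b)ᶜ) *
        (prodBernoulli w).real (openConn a b ∩ (openConn o a)ᶜ) := by
  classical
  set μ := prodBernoulli w with hμ
  have hmeas : ∀ Z : Set (BondConfig V), MeasurableSet Z := fun _ => MeasurableSet.of_discrete
  have hoa' : o ∉ ({a} : Set V) := fun h => hoa (mem_singleton_iff.1 h)
  have hba' : b ∉ ({a} : Set V) := fun h => hab (mem_singleton_iff.1 h).symm
  have main := pinned_negCorrelation w ({a} : Set V) hoa' hba' hob
  have hba : (openConn b a : Set (BondConfig V)) = openConn a b := by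
    ext ω
    exact ⟨fun h => SimpleGraph.Reachable.symm h, fun h => SimpleGraph.Reachable.symm h⟩
  simp only [biUnion_singleton, hba] at main
  rw [← hμ] at main
  set D : Set (BondConfig V) := (openConnIn ({a}ᶜ : Set V) o b)ᶜ with hD
  set Ea : Set (BondConfig V) := openConn o a with hEa
  set Eb : Set (BondConfig V) := openConn a b with hEb
  -- `main : μ.real D * μ.real (D ∩ (Ea ∩ Eb)) ≤ μ.real (D ∩ Ea) * μ.real (D ∩ Eb)`
  -- the four cells as pieces of `D`
  have hDof_oa : ∀ ω, ω ∈ Ea → ω ∉ Eb → ω ∈ D := fun ω h1 h2 h =>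
    h2 ((SimpleGraph.Reachable.symm h1).trans (reachable_of_openConnIn h))
  have hDof_ab : ∀ ω, ω ∈ Eb → ω ∉ Ea → ω ∈ D := fun ω h1 h2 h =>
    h2 ((reachable_of_openConnIn h).trans (SimpleGraph.Reachable.symm h1))
  have hDof_ob : ∀ ω, ω ∉ (openConn o b : Set (BondConfig V)) → ω ∈ D := fun ω h1 h =>
    h1 (reachable_of_openConnIn h)
  have s1 : Ea ∩ Eb ∩ (openConnIn ({a}ᶜ : Set V) o b)ᶜ = D ∩ (Ea ∩ Eb) := by
    ext ω; simp only [mem_inter_iff]; tauto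
  have s2 : Eaᶜ ∩ Ebᶜ ∩ (openConn o b)ᶜ = (D \ Ea) \ Eb := by
    ext ω
    simp only [mem_inter_iff, mem_sdiff, mem_compl_iff]
    constructor
    · rintro ⟨⟨h1, h2⟩, h3⟩
      exact ⟨⟨hDof_ob ω h3, h1⟩, h2⟩
    · rintro ⟨⟨hd, h1⟩, h2⟩
      exact ⟨⟨h1, h2⟩, not_reachable_of_not_openConnIn_of_not_reachable hd h1⟩
  have s3 : Ea ∩ Ebᶜ = (D ∩ Ea) \ Eb := by
    ext ω
    simp only [mem_inter_iff, mem_sdiff, mem_compl_iff]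
    constructor
    · rintro ⟨h1, h2⟩
      exact ⟨⟨hDof_oa ω h1 h2, h1⟩, h2⟩
    · rintro ⟨⟨-, h1⟩, h2⟩
      exact ⟨h1, h2⟩
  have s4 : Eb ∩ Eaᶜ = (D \ Ea) ∩ Eb := by
    ext ω
    simp only [mem_inter_iff, mem_sdiff, mem_compl_iff]
    constructor
    · rintro ⟨h1, h2⟩
      exact ⟨⟨hDof_ab ω h1 h2, h2⟩, h1⟩
    · rintro ⟨⟨-, h2⟩, h1⟩
      exact ⟨h1, h2⟩
  have s5 : (D ∩ Ea) ∩ Eb = D ∩ (Ea ∩ Eb) := by rw [inter_assoc]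
  have s6 : (D ∩ Eb) ∩ Ea = D ∩ (Ea ∩ Eb) := by
    ext ω; simp only [mem_inter_iff]; tauto
  have s7 : (D ∩ Eb) \ Ea = (D \ Ea) ∩ Eb := by
    ext ω; simp only [mem_inter_iff, mem_sdiff]; tauto
  -- additivity
  have a1 := measureReal_inter_add_sdiff (μ := μ) (s := D ∩ Ea) (hmeas Eb)
  have a2 := measureReal_inter_add_sdiff (μ := μ) (s := D ∩ Eb) (hmeas Ea)
  have a3 := measureReal_inter_add_sdiff (μ := μ) (s := D) (hmeas Ea)
  have a4 := measureReal_inter_add_sdiff (μ := μ) (s := D \ Ea) (hmeas Eb)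
  rw [s5] at a1
  rw [s6, s7] at a2
  rw [s1, s2, s3, s4]
  have eo : μ.real (D ∩ Ea) = μ.real (D ∩ (Ea ∩ Eb)) + μ.real ((D ∩ Ea) \ Eb) := a1.symm
  have eb : μ.real (D ∩ Eb) = μ.real (D ∩ (Ea ∩ Eb)) + μ.real ((D \ Ea) ∩ Eb) := a2.symm
  have eD : μ.real D = μ.real (D ∩ (Ea ∩ Eb)) + μ.real ((D ∩ Ea) \ Eb) +
      (μ.real ((D \ Ea) ∩ Eb) + μ.real ((D \ Ea) \ Eb)) := by
    rw [← a3, ← a4, eo]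
  rw [eD, eo, eb] at main
  linear_combination main

end Main

end PinnedCA

end

end Summit.CriticalPhenomena.PercolationContinuityZ3.Theorems
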